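import Literature.NumberTheory.Sieve.BoundedGapsNumberFieldsProofs
import HarnessLib

/-!
# Residue classes of an ideal in a general coordinate box of `𝓞_K`, uniformly in the modulus

Topic `Literature/NumberTheory/Sieve`, namespace `Literature.NumberTheory.Sieve.CastilloEtAl2015`
(continuation of `BoundedGapsNumberFieldsProofs.lean`, §2.1 of A. Castillo, C. Hall,
R. J. Lemke Oliver, P. Pollack, L. Thompson, *Bounded gaps between primes in number fields and
function fields*, Proc. AMS 143 (2015) = arXiv:1403.5808). Everything in this file is PROVED.

`BoundedGapsNumberFieldsProofs.abs_card_box₀_coset_sub_le_uniform` counts the elements of a residue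
class `α₀ + 𝔮` in the cube `A₀(N) = {α : 0 < σ(α) ≤ N ∀σ}` of a totally real `K`, uniformly in
`𝔮`: `N^d/(N𝔮 √|D_K|) + O(1 + (N^d/N𝔮)^{1−1/d})`. The proof of Lemma 2.3 of the paper needs the
same count for slightly more general regions ("The first `O`-term is needed in the number field
case, since it is `α` that is restricted to `A(N)` instead of `α + h_m`", proof of Lemma 2.3, p. 8):
the symmetric difference of `A(N)` and its translate `A(N) + h` is covered by `3d` coordinate slabs
of thickness `O(1)`. This file runs the argument of §2.1 (Minkowski-short `x₁ ∈ 𝔮`, fibration of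
`α₀ + 𝔮` over `𝔮/(x₁)`, the fixed lattice `ι(𝓞_K)` in coordinate boxes —
`Literature.Algebra.EuclideanLattices.abs_card_inter_coordBox_sub_le`) for an ARBITRARY coordinate
box `cbox lo hi = {α : lo_w < σ_w(α) ≤ hi_w ∀ w}`:

* `cbox K lo hi`, `mem_cbox`, `box₀_eq_cbox` (`A₀(N) = cbox 0 N`), `finite_cbox`;
* `gfibreBox / gfibreLo / gfibreHi` and their inclusions, `card_gfibre_eq` (the fibre
  `{γ : β + x₁γ ∈ cbox}` is the real lattice `ι(𝓞_K)` in a coordinate box of sides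
  `(hi_w − lo_w)/|σ_w x₁|`), `card_coset_eq_sum_of_finite` (fibration over `𝔮/(x₁)`);
* `abs_card_cbox_coset_sub_le_of_short` (one short `x₁`),
  **`abs_card_cbox_coset_sub_le_uniform`**: there is `C = C(K)` with
  `|#{α ∈ cbox lo hi : α ≡ α₀ (𝔮)} − ∏_w (hi_w − lo_w)/(N𝔮 √|D_K|)| ≤ C (1 + (N^d/N𝔮)^{1−1/d})`
  for every nonzero `𝔮`, every `N ≥ 1`, all `lo ≤ hi` with sides `hi_w − lo_w ≤ N`, every `α₀`;
* the shift estimate of Lemma 2.3: `shiftConst` (`c(h) = 1 + ∑_w |σ_w h|`), `slabLo / slabHi`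
  (the `3d` slabs `S(w₀, jN)`), `mem_slab_of_xor_mem_box` (the symmetric difference of `A(N)` and
  `A(N) + h` lies in the slabs), `card_slab_coset_le`, **`card_xor_box_shift_coset_le`**:
  `#{β : (β ∈ A(N)) xor (β − h ∈ A(N)), β ≡ a (𝔮)} ≤ C_h (N^{d−1}/N𝔮 + 1 + (N^d/N𝔮)^{1−1/d})`.

## References

* Castillo–Hall–Lemke Oliver–Pollack–Thompson, arXiv:1403.5808, §2.1 (the display
  `|A(N)|/|𝔮| + O(|∂A(N,𝔮)|)`, `|∂A(N,𝔮)| ≪ 1 + (|A(N)|/|𝔮|)^{1−1/d}`) and proof of Lemma 2.3 (p. 8,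
  the first `O`-term). [CastilloEtAl2015]
* D. A. Marcus, *Number Fields*, 2nd ed., Ch. 6, Lemma 2 (lattice points). [Marcus2018]
-/

noncomputable section

open NumberField NumberField.InfinitePlace NumberField.mixedEmbedding Set MeasureTheory Module
  Bornology
open scoped nonZeroDivisors Classical

namespace Literature.NumberTheory.Sieve.CastilloEtAl2015

variable (K : Type*) [Field K] [NumberField K]

/-! ### General coordinate boxes -/

/-- The coordinate box `{α ∈ 𝓞_K : lo_w < σ_w(α) ≤ hi_w at every real place w}` (for totally real
`K` these are all places; `A₀(N)` is `lo = 0`, `hi = N`). [cite: CastilloEtAl2015, §2.1 (the region of Minkowski space)] -/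
def cbox (lo hi : {w : InfinitePlace K // w.IsReal} → ℝ) : Set (𝓞 K) :=
  {α | ∀ w, (mixedEmbedding K (α : K)).1 w ∈ Ioc (lo w) (hi w)}

variable {K}

omit [NumberField K] in
/-- Membership in `cbox`. [folklore] -/
theorem mem_cbox {lo hi : {w : InfinitePlace K // w.IsReal} → ℝ} {α : 𝓞 K} :
    α ∈ cbox K lo hi ↔ ∀ w, (mixedEmbedding K (α : K)).1 w ∈ Ioc (lo w) (hi w) := Iff.rfl

omit [NumberField K] in
/-- `A₀(N)` is the box `(0, N]^d` for totally real `K`. [cite: CastilloEtAl2015, §2.1 (definition of A₀(N))] -/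
theorem box₀_eq_cbox [IsTotallyReal K] (N : ℝ) :
    box₀ K N = cbox K (fun _ => 0) (fun _ => N) := by
  haveI := isEmpty_isComplex (K := K)
  ext α
  simp only [box₀, Set.mem_setOf_eq, IsEmpty.forall_iff, and_true, cbox]

omit [NumberField K] in
/-- Boxes are monotone in the corners. [folklore] -/
theorem cbox_mono {lo hi lo' hi' : {w : InfinitePlace K // w.IsReal} → ℝ} (hlo : ∀ w, lo' w ≤ lo w)
    (hhi : ∀ w, hi w ≤ hi' w) : cbox K lo hi ⊆ cbox K lo' hi' :=
  fun _ hα w => ⟨(hlo w).trans_lt (hα w).1, (hα w).2.trans (hhi w)⟩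

section TotallyReal

variable [IsTotallyReal K]

omit [NumberField K] [IsTotallyReal K] in
/-- `realEmb` is the coordinate map of `cbox`. [folklore] -/
theorem mem_cbox_iff_realEmb {lo hi : {w : InfinitePlace K // w.IsReal} → ℝ} {α : 𝓞 K} :
    α ∈ cbox K lo hi ↔ ∀ w, realEmb K α w ∈ Ioc (lo w) (hi w) := Iff.rfl

omit [NumberField K] [IsTotallyReal K] in
/-- Translating a box: `α + h ∈ cbox (lo + ι h) (hi + ι h) ↔ α ∈ cbox lo hi`. [folklore] -/
theorem add_mem_cbox_iff {lo hi : {w : InfinitePlace K // w.IsReal} → ℝ} {α h : 𝓞 K} :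
    α + h ∈ cbox K (fun w => lo w + realEmb K h w) (fun w => hi w + realEmb K h w) ↔
      α ∈ cbox K lo hi := by
  simp only [mem_cbox_iff_realEmb, realEmb_add, Pi.add_apply, Set.mem_Ioc, add_lt_add_iff_right,
    add_le_add_iff_right]

/-- A coordinate box contains finitely many algebraic integers (a bounded piece of the lattice
`ι(𝓞_K) ⊂ ℝ^{r₁}`). [cite: CastilloEtAl2015, §2.1 (𝓞_K as a lattice in Minkowski space)] -/
theorem finite_cbox (lo hi : {w : InfinitePlace K // w.IsReal} → ℝ) : (cbox K lo hi).Finite := by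
  have hbdd : IsBounded (Set.univ.pi fun w : {w : InfinitePlace K // w.IsReal} => Icc (lo w) (hi w)) := by
    rw [Set.pi_univ_Icc]; exact Metric.isBounded_Icc lo hi
  have hfin := ZSpan.setFinite_inter (realLatticeBasis K) hbdd
  have hsub : cbox K lo hi ⊆ realEmb K ⁻¹'
      ((Set.univ.pi fun w : {w : InfinitePlace K // w.IsReal} => Icc (lo w) (hi w)) ∩
        (Submodule.span ℤ (Set.range (realLatticeBasis K)) : Set _)) := fun α hα =>
    ⟨Set.mem_univ_pi.2 fun w => ⟨(hα w).1.le, (hα w).2⟩, (mem_span_realLatticeBasis K).2 ⟨α, rfl⟩⟩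
  exact (hfin.preimage (realEmb_injective K).injOn).subset hsub

/-! ### The fibres: a coset of a principal lattice in a general box is a coordinate box -/

variable (K)

omit [NumberField K] [IsTotallyReal K] in
/-- The coordinate box in `ℝ^{r₁}` describing `{γ : β + x₁γ ∈ cbox lo hi}`:
`lo_w < t_w + s_w y_w ≤ hi_w` with `t = ι(β)`, `s = ι(x₁)`.
[cite: CastilloEtAl2015, §2.1 (translates of the fundamental parallelogram)] -/
def gfibreBox (lo hi t s : {w : InfinitePlace K // w.IsReal} → ℝ) :
    Set ({w : InfinitePlace K // w.IsReal} → ℝ) :=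
  {y | ∀ w, t w + s w * y w ∈ Ioc (lo w) (hi w)}

omit [NumberField K] [IsTotallyReal K] in
/-- Lower corner of `gfibreBox`. [folklore] -/
def gfibreLo (lo hi t s : {w : InfinitePlace K // w.IsReal} → ℝ)
    (w : {w : InfinitePlace K // w.IsReal}) : ℝ :=
  if 0 < s w then (lo w - t w) / s w else (hi w - t w) / s w

omit [NumberField K] [IsTotallyReal K] in
/-- Upper corner of `gfibreBox`. [folklore] -/
def gfibreHi (lo hi t s : {w : InfinitePlace K // w.IsReal} → ℝ)
    (w : {w : InfinitePlace K // w.IsReal}) : ℝ :=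
  if 0 < s w then (hi w - t w) / s w else (lo w - t w) / s w

omit [NumberField K] [IsTotallyReal K] in
/-- The sides of `gfibreBox` are `(hi_w − lo_w)/|s_w|`. [folklore] -/
theorem gfibreHi_sub_gfibreLo {lo hi t s : {w : InfinitePlace K // w.IsReal} → ℝ}
    (hs : ∀ w, s w ≠ 0) (w : {w : InfinitePlace K // w.IsReal}) :
    gfibreHi K lo hi t s w - gfibreLo K lo hi t s w = (hi w - lo w) / |s w| := by
  simp only [gfibreHi, gfibreLo]
  split_ifs with h
  · rw [abs_of_pos h]; field_simp; ring
  · have h' : s w < 0 := lt_of_le_of_ne (not_lt.1 h) (hs w)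
    rw [abs_of_neg h']; field_simp; ring

omit [NumberField K] [IsTotallyReal K] in
/-- The open coordinate box lies in `gfibreBox`. [folklore] -/
theorem pi_Ioo_subset_gfibreBox {lo hi t s : {w : InfinitePlace K // w.IsReal} → ℝ}
    (hs : ∀ w, s w ≠ 0) :
    (Set.univ.pi fun w => Ioo (gfibreLo K lo hi t s w) (gfibreHi K lo hi t s w)) ⊆
      gfibreBox K lo hi t s := by
  intro y hy w
  have h := Set.mem_univ_pi.1 hy w
  simp only [gfibreLo, gfibreHi, Set.mem_Ioo] at h
  split_ifs at h with hsw
  · rw [div_lt_iff₀ hsw, lt_div_iff₀ hsw] at h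
    constructor <;> nlinarith [h.1, h.2]
  · have h' : s w < 0 := lt_of_le_of_ne (not_lt.1 hsw) (hs w)
    rw [div_lt_iff_of_neg h', lt_div_iff_of_neg h'] at h
    constructor <;> nlinarith [h.1, h.2]

omit [NumberField K] [IsTotallyReal K] in
/-- `gfibreBox` lies in the closed coordinate box. [folklore] -/
theorem gfibreBox_subset_pi_Icc {lo hi t s : {w : InfinitePlace K // w.IsReal} → ℝ}
    (hs : ∀ w, s w ≠ 0) :
    gfibreBox K lo hi t s ⊆
      Set.univ.pi fun w => Icc (gfibreLo K lo hi t s w) (gfibreHi K lo hi t s w) := by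
  intro y hy
  refine Set.mem_univ_pi.2 fun w => ?_
  have h := hy w
  simp only [gfibreLo, gfibreHi, Set.mem_Icc, Set.mem_Ioc] at h ⊢
  split_ifs with hsw
  · rw [div_le_iff₀ hsw, le_div_iff₀ hsw]
    constructor <;> nlinarith [h.1, h.2]
  · have h' : s w < 0 := lt_of_le_of_ne (not_lt.1 hsw) (hs w)
    rw [div_le_iff_of_neg h', le_div_iff_of_neg h']
    constructor <;> nlinarith [h.1, h.2]

omit [NumberField K] [IsTotallyReal K] in
/-- `lo' ≤ hi'` whenever `lo ≤ hi`. [folklore] -/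
theorem gfibreLo_le_gfibreHi {lo hi t s : {w : InfinitePlace K // w.IsReal} → ℝ}
    (hlohi : ∀ w, lo w ≤ hi w) (hs : ∀ w, s w ≠ 0) (w : {w : InfinitePlace K // w.IsReal}) :
    gfibreLo K lo hi t s w ≤ gfibreHi K lo hi t s w := by
  have := gfibreHi_sub_gfibreLo K hs w (lo := lo) (hi := hi) (t := t)
  have h0 : 0 ≤ (hi w - lo w) / |s w| := div_nonneg (sub_nonneg.2 (hlohi w)) (abs_nonneg _)
  linarith

/-- **The fibre bijection** for a general box: `{γ ∈ 𝓞_K : β + x₁γ ∈ cbox lo hi}` corresponds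
under `ι` to the points of `ι(𝓞_K)` in `gfibreBox lo hi ι(β) ι(x₁)`.
[cite: CastilloEtAl2015, §2.1 (the constraints correspond to a region of Minkowski space)] -/
theorem card_gfibre_eq (lo hi : {w : InfinitePlace K // w.IsReal} → ℝ) (x₁ β : 𝓞 K) :
    Nat.card {γ : 𝓞 K // β + x₁ * γ ∈ cbox K lo hi} =
      Nat.card ((gfibreBox K lo hi (realEmb K β) (realEmb K x₁)) ∩
        (Submodule.span ℤ (Set.range (realLatticeBasis K)) :
          Set ({w : InfinitePlace K // w.IsReal} → ℝ)) : Set _) := by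
  have hmem : ∀ γ : 𝓞 K, β + x₁ * γ ∈ cbox K lo hi ↔
      realEmb K γ ∈ gfibreBox K lo hi (realEmb K β) (realEmb K x₁) := by
    intro γ
    simp only [mem_cbox_iff_realEmb, gfibreBox, Set.mem_setOf_eq, realEmb_add, realEmb_mul,
      Pi.add_apply, Pi.mul_apply]
  let f : {γ : 𝓞 K // β + x₁ * γ ∈ cbox K lo hi} →
      ((gfibreBox K lo hi (realEmb K β) (realEmb K x₁)) ∩
        (Submodule.span ℤ (Set.range (realLatticeBasis K)) : Set _) : Set _) :=
    fun γ => ⟨realEmb K γ.1, (hmem _).1 γ.2, (mem_span_realLatticeBasis K).2 ⟨γ.1, rfl⟩⟩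
  refine Nat.card_congr (Equiv.ofBijective f ⟨fun a b h => ?_, fun y => ?_⟩)
  · exact Subtype.ext (realEmb_injective K (congrArg Subtype.val h))
  · obtain ⟨α, hα⟩ := (mem_span_realLatticeBasis K).1 y.2.2
    refine ⟨⟨α, (hmem α).2 (hα ▸ y.2.1)⟩, Subtype.ext hα⟩

omit [NumberField K] [IsTotallyReal K] in
/-- **The fibration of the count over `𝔮/(x₁)`** for an arbitrary finite region `S`: for
`x₁ ∈ 𝔮 ∖ {0}` the elements of `S ∩ (α₀ + 𝔮)` split according to the class of `α − α₀` in
`𝔮/(x₁)`; the class `b` (representative `r_b ∈ 𝔮`) contributes `#{γ : α₀ + r_b + x₁γ ∈ S}`.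
[cite: CastilloEtAl2015, §2.1 (translates of the fundamental parallelogram)] -/
theorem card_coset_eq_sum_of_finite {S : Set (𝓞 K)} (hS : S.Finite) {𝔮 : Ideal (𝓞 K)} {x₁ : 𝓞 K}
    (hx₁0 : x₁ ≠ 0) (hx₁ : x₁ ∈ 𝔮) (α₀ : 𝓞 K) [Fintype (𝓞 K ⧸ Ideal.span ({x₁} : Set (𝓞 K)))] :
    ∃ r : (𝓞 K ⧸ Ideal.span ({x₁} : Set (𝓞 K))) → 𝓞 K,
      Nat.card {α : 𝓞 K // α ∈ S ∧ α - α₀ ∈ 𝔮} =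
        ∑ b ∈ Finset.univ.filter (· ∈ 𝔮.map (Ideal.Quotient.mk (Ideal.span ({x₁} : Set (𝓞 K))))),
          Nat.card {γ : 𝓞 K // (α₀ + r b) + x₁ * γ ∈ S} := by
  set I : Ideal (𝓞 K) := Ideal.span ({x₁} : Set (𝓞 K)) with hI
  set mk := Ideal.Quotient.mk I with hmk
  have hrep : ∀ b : 𝓞 K ⧸ I, b ∈ 𝔮.map mk → ∃ r ∈ 𝔮, mk r = b := fun b hb =>
    (Ideal.mem_map_iff_of_surjective mk Ideal.Quotient.mk_surjective).1 hb
  choose! r hr𝔮 hrb using hrep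
  refine ⟨r, ?_⟩
  have hfin : {α : 𝓞 K | α ∈ S ∧ α - α₀ ∈ 𝔮}.Finite := hS.subset fun α h => h.1
  set T := hfin.toFinset with hT
  have hcardT : Nat.card {α : 𝓞 K // α ∈ S ∧ α - α₀ ∈ 𝔮} = T.card := by
    rw [hT, ← Set.ncard_eq_toFinset_card _ hfin, ← Nat.card_coe_set_eq]
    rfl
  rw [hcardT, Finset.card_eq_sum_card_fiberwise (f := fun α => mk (α - α₀))
    (t := Finset.univ.filter (· ∈ 𝔮.map mk)) ?_]
  · refine Finset.sum_congr (by ext b; simp) fun b hb => ?_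
    have hbT : b ∈ 𝔮.map mk := (Finset.mem_filter.1 hb).2
    have hrb' : mk (r b) = b := hrb b hbT
    have hr𝔮' : r b ∈ 𝔮 := hr𝔮 b hbT
    rw [← Fintype.card_coe, ← Nat.card_eq_fintype_card]
    symm
    refine Nat.card_congr (Equiv.ofBijective
      (fun γ : {γ : 𝓞 K // (α₀ + r b) + x₁ * γ ∈ S} =>
        (⟨α₀ + r b + x₁ * γ.1, ?_⟩ : {α // α ∈ T.filter fun α => mk (α - α₀) = b})) ⟨?_, ?_⟩)
    · rw [Finset.mem_filter, hT, Set.Finite.mem_toFinset]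
      refine ⟨⟨γ.2, ?_⟩, ?_⟩
      · have : α₀ + r b + x₁ * γ.1 - α₀ = r b + x₁ * γ.1 := by ring
        rw [this]
        exact 𝔮.add_mem hr𝔮' (𝔮.mul_mem_right _ hx₁)
      · have : α₀ + r b + x₁ * γ.1 - α₀ = r b + x₁ * γ.1 := by ring
        rw [this, map_add, map_mul, hrb']
        have h0 : mk x₁ = 0 := Ideal.Quotient.eq_zero_iff_mem.2 (Ideal.mem_span_singleton_self x₁)
        rw [h0, zero_mul, add_zero]
    · intro γ γ' h
      have h' : α₀ + r b + x₁ * γ.1 = α₀ + r b + x₁ * γ'.1 := congrArg Subtype.val h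
      exact Subtype.ext (mul_left_cancel₀ hx₁0 (add_left_cancel h'))
    · rintro ⟨α, hα⟩
      rw [Finset.mem_filter, hT, Set.Finite.mem_toFinset] at hα
      obtain ⟨⟨hαS, -⟩, hαb⟩ := hα
      have hmem : α - α₀ - r b ∈ I := by
        rw [← Ideal.Quotient.eq, hrb']
        exact hαb
      obtain ⟨γ, hγ⟩ := Ideal.mem_span_singleton'.1 hmem
      have hα' : α = α₀ + r b + x₁ * γ := by rw [mul_comm, hγ]; ring
      refine ⟨⟨γ, hα' ▸ hαS⟩, Subtype.ext hα'.symm⟩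
  · intro α hα
    have hα' : α ∈ {α : 𝓞 K | α ∈ S ∧ α - α₀ ∈ 𝔮} := by
      simpa only [hT, Set.Finite.coe_toFinset] using hα
    exact Finset.mem_filter.2 ⟨Finset.mem_univ _, Ideal.mem_map_of_mem _ hα'.2⟩

/-! ### One short element, then uniformly in the modulus -/

/-- **Uniform count for one short element `x₁ ∈ 𝔮`, general box**: if all conjugates of `x₁ ≠ 0`
are `< C₀`, then for every box `cbox lo hi` with `lo ≤ hi` and sides `≤ N` (`N > 0`) and every `α₀`,
with `L = max 1 (N C₀^{d−1}/N𝔮)`,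
`|#(cbox ∩ (α₀ + 𝔮)) − κ ∏_w (hi_w − lo_w)| ≤ (|N x₁|/N𝔮) · C_b · L^{d−1}`,
`κ = (|N x₁|/N𝔮)/(|N x₁| vol P)`. [cite: CastilloEtAl2015, §2.1 (|∂A(N,𝔮)| ≪ (|A(N)|/|𝔮|)^{1−1/d})] -/
theorem abs_card_cbox_coset_sub_le_of_short {C_b : ℝ}
    (hCb : ∀ (lo hi : {w : InfinitePlace K // w.IsReal} → ℝ) (L : ℝ), 1 ≤ L → (∀ j, lo j ≤ hi j) →
      (∀ j, hi j - lo j ≤ L) → ∀ B : Set ({w : InfinitePlace K // w.IsReal} → ℝ),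
        (Set.univ.pi fun j => Ioo (lo j) (hi j)) ⊆ B → B ⊆ (Set.univ.pi fun j => Icc (lo j) (hi j)) →
        |(Nat.card (B ∩ (Submodule.span ℤ (Set.range (realLatticeBasis K)) : Set _) : Set _) : ℝ) -
            (∏ j, (hi j - lo j)) / volume.real (ZSpan.fundamentalDomain (realLatticeBasis K))| ≤
          C_b * L ^ (Fintype.card {w : InfinitePlace K // w.IsReal} - 1))
    {𝔮 : Ideal (𝓞 K)} {x₁ : 𝓞 K} (hx₁0 : x₁ ≠ 0) (hx₁ : x₁ ∈ 𝔮) {C₀ : ℝ}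
    (hlt : ∀ w : InfinitePlace K, w (x₁ : K) < C₀) {N : ℝ} (hN : 0 < N)
    {lo hi : {w : InfinitePlace K // w.IsReal} → ℝ} (hlohi : ∀ w, lo w ≤ hi w)
    (hside : ∀ w, hi w - lo w ≤ N) (α₀ : 𝓞 K) :
    |(Nat.card {α : 𝓞 K // α ∈ cbox K lo hi ∧ α - α₀ ∈ 𝔮} : ℝ) -
        ((Ideal.absNorm (Ideal.span ({x₁} : Set (𝓞 K))) : ℝ) / Ideal.absNorm 𝔮) /
          (|(Algebra.norm ℚ (x₁ : K) : ℝ)| *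
            volume.real (ZSpan.fundamentalDomain (realLatticeBasis K))) * ∏ w, (hi w - lo w)| ≤
      ((Ideal.absNorm (Ideal.span ({x₁} : Set (𝓞 K))) : ℝ) / Ideal.absNorm 𝔮) * C_b *
        (max 1 (N * C₀ ^ (finrank ℚ K - 1) / Ideal.absNorm 𝔮)) ^ (finrank ℚ K - 1) := by
  set d : ℕ := finrank ℚ K with hd
  set n : ℝ := (Ideal.absNorm 𝔮 : ℝ) with hn
  set s := realEmb K x₁ with hsdef
  set L : ℝ := max 1 (N * C₀ ^ (d - 1) / n) with hL
  have hC₀ : 0 < C₀ := (apply_nonneg _ _).trans_lt (hlt (Classical.arbitrary _))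
  have h𝔮0 : 𝔮 ≠ ⊥ := fun h => hx₁0 (by simpa [h] using hx₁)
  have hn0 : 0 < n := by
    rw [hn]; exact_mod_cast Nat.pos_of_ne_zero (by rwa [Ne, Ideal.absNorm_eq_zero_iff])
  have hslo : ∀ w, n / C₀ ^ (d - 1) ≤ |s w| := fun w => by
    rw [hsdef, abs_realEmb]; exact le_apply_of_forall_lt K hx₁ hx₁0 hlt w.1
  have hspos : ∀ w, 0 < |s w| := fun w => lt_of_lt_of_le (by positivity) (hslo w)
  have hs0 : ∀ w, s w ≠ 0 := fun w => abs_pos.1 (hspos w)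
  have hcardR : Fintype.card {w : InfinitePlace K // w.IsReal} = d := by
    rw [hd, IsTotallyReal.finrank]
  -- sides of the fibre boxes
  have hside' : ∀ (t : {w : InfinitePlace K // w.IsReal} → ℝ) (w),
      gfibreHi K lo hi t s w - gfibreLo K lo hi t s w ≤ L := by
    intro t w
    rw [gfibreHi_sub_gfibreLo K hs0]
    calc (hi w - lo w) / |s w| ≤ N / |s w| :=
          div_le_div_of_nonneg_right (hside w) (abs_nonneg _)
      _ ≤ N / (n / C₀ ^ (d - 1)) := by gcongr; exact hslo w
      _ = N * C₀ ^ (d - 1) / n := by field_simp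
      _ ≤ L := le_max_right _ _
  have hL1 : 1 ≤ L := le_max_left _ _
  -- the product of the sides
  have hprod : ∀ t : {w : InfinitePlace K // w.IsReal} → ℝ,
      ∏ w, (gfibreHi K lo hi t s w - gfibreLo K lo hi t s w) =
        (∏ w, (hi w - lo w)) / |(Algebra.norm ℚ (x₁ : K) : ℝ)| := by
    intro t
    simp_rw [gfibreHi_sub_gfibreLo K hs0, Finset.prod_div_distrib]
    congr 1
    rw [← prod_isReal_apply_eq_abs_norm]
    exact Finset.prod_congr rfl fun w _ => by rw [hsdef, abs_realEmb]
  -- fibration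
  haveI : Fintype (𝓞 K ⧸ Ideal.span ({x₁} : Set (𝓞 K))) :=
    @Fintype.ofFinite _ (Ideal.finiteQuotientOfFreeOfNeBot _ (by simpa using hx₁0))
  obtain ⟨r, hr⟩ := card_coset_eq_sum_of_finite K (finite_cbox lo hi) hx₁0 hx₁ α₀
  set T := Finset.univ.filter
    (· ∈ 𝔮.map (Ideal.Quotient.mk (Ideal.span ({x₁} : Set (𝓞 K))))) with hT
  have hTcard : (T.card : ℝ) = (Ideal.absNorm (Ideal.span ({x₁} : Set (𝓞 K))) : ℝ) / n := by
    rw [eq_div_iff hn0.ne', hn]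
    have h := card_map_mk_mul_absNorm K hx₁ (x₁ := x₁)
    have hT' : T.card = Nat.card (𝔮.map (Ideal.Quotient.mk (Ideal.span ({x₁} : Set (𝓞 K))))) := by
      rw [hT, Nat.card_eq_fintype_card, ← Fintype.card_subtype]
    rw [hT']
    exact_mod_cast h
  rw [hr]
  push_cast
  set P : ℝ := ∏ w, (hi w - lo w) with hP
  -- termwise bound
  have hterm : ∀ b ∈ T, |(Nat.card {γ : 𝓞 K // α₀ + r b + x₁ * γ ∈ cbox K lo hi} : ℝ) -
      (P / |(Algebra.norm ℚ (x₁ : K) : ℝ)|) /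
        volume.real (ZSpan.fundamentalDomain (realLatticeBasis K))| ≤ C_b * L ^ (d - 1) := by
    intro b _
    rw [card_gfibre_eq K lo hi x₁ (α₀ + r b), hP, ← hprod (realEmb K (α₀ + r b)), ← hcardR]
    exact hCb _ _ L hL1 (gfibreLo_le_gfibreHi K hlohi hs0) (hside' _) _
      (pi_Ioo_subset_gfibreBox K hs0) (gfibreBox_subset_pi_Icc K hs0)
  have hmain : (T.card : ℝ) * ((P / |(Algebra.norm ℚ (x₁ : K) : ℝ)|) /
      volume.real (ZSpan.fundamentalDomain (realLatticeBasis K))) =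
      ((Ideal.absNorm (Ideal.span ({x₁} : Set (𝓞 K))) : ℝ) / n) /
        (|(Algebra.norm ℚ (x₁ : K) : ℝ)| * volume.real (ZSpan.fundamentalDomain (realLatticeBasis K))) *
          P := by
    rw [hTcard]; ring
  rw [← hmain]
  have hsum : ∑ b ∈ T, (Nat.card {γ : 𝓞 K // α₀ + r b + x₁ * γ ∈ cbox K lo hi} : ℝ) -
      (T.card : ℝ) * ((P / |(Algebra.norm ℚ (x₁ : K) : ℝ)|) /
        volume.real (ZSpan.fundamentalDomain (realLatticeBasis K))) =
      ∑ b ∈ T, ((Nat.card {γ : 𝓞 K // α₀ + r b + x₁ * γ ∈ cbox K lo hi} : ℝ) -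
        (P / |(Algebra.norm ℚ (x₁ : K) : ℝ)|) /
          volume.real (ZSpan.fundamentalDomain (realLatticeBasis K))) := by
    rw [Finset.sum_sub_distrib, Finset.sum_const, nsmul_eq_mul]
  rw [hsum]
  calc |∑ b ∈ T, ((Nat.card {γ : 𝓞 K // α₀ + r b + x₁ * γ ∈ cbox K lo hi} : ℝ) -
        (P / |(Algebra.norm ℚ (x₁ : K) : ℝ)|) /
          volume.real (ZSpan.fundamentalDomain (realLatticeBasis K)))|
      ≤ ∑ b ∈ T, |(Nat.card {γ : 𝓞 K // α₀ + r b + x₁ * γ ∈ cbox K lo hi} : ℝ) -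
        (P / |(Algebra.norm ℚ (x₁ : K) : ℝ)|) /
          volume.real (ZSpan.fundamentalDomain (realLatticeBasis K))| := Finset.abs_sum_le_sum_abs _ _
    _ ≤ ∑ b ∈ T, C_b * L ^ (d - 1) := Finset.sum_le_sum hterm
    _ = (T.card : ℝ) * (C_b * L ^ (d - 1)) := by rw [Finset.sum_const, nsmul_eq_mul]
    _ = ((Ideal.absNorm (Ideal.span ({x₁} : Set (𝓞 K))) : ℝ) / n) * C_b * L ^ (d - 1) := by
        rw [hTcard]; ring

/-- **The residue-class count in a general coordinate box, uniformly in the modulus** (§2.1 for the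
regions needed in the proof of Lemma 2.3): there is `C = C(K)` such that for every nonzero ideal `𝔮`,
every `N ≥ 1`, every coordinate box `cbox lo hi` with `lo ≤ hi` and all sides `hi_w − lo_w ≤ N`, and
every `α₀`,
`|#{α ∈ cbox lo hi : α ≡ α₀ (mod 𝔮)} − ∏_w (hi_w − lo_w)/(N𝔮 √|D_K|)| ≤ C (1 + (N^d/N𝔮)^{1−1/d})`.
Proof as for `abs_card_box₀_coset_sub_le_uniform` (short `x₁ ∈ 𝔮`, fibration, fixed-lattice box
count); the constant `vol(P) = √|D_K|` is identified by comparison with that result on the cube.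
[cite: CastilloEtAl2015, §2.1 (|∂A(N,𝔮)| ≪ 1 + (|A(N)|/|𝔮|)^{1−1/d}) and proof of Lemma 2.3 (first O-term)] -/
theorem abs_card_cbox_coset_sub_le_uniform :
    ∃ C : ℝ, ∀ (𝔮 : (Ideal (𝓞 K))⁰) (N : ℝ), 1 ≤ N →
      ∀ (lo hi : {w : InfinitePlace K // w.IsReal} → ℝ), (∀ w, lo w ≤ hi w) →
        (∀ w, hi w - lo w ≤ N) → ∀ α₀ : 𝓞 K,
      |(Nat.card {α : 𝓞 K // α ∈ cbox K lo hi ∧ α - α₀ ∈ (𝔮 : Ideal (𝓞 K))} : ℝ) -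
          (∏ w, (hi w - lo w)) / (Ideal.absNorm (𝔮 : Ideal (𝓞 K)) * √|discr K|)| ≤
        C * (1 + (N ^ finrank ℚ K / Ideal.absNorm (𝔮 : Ideal (𝓞 K))) ^
          (1 - 1 / (finrank ℚ K : ℝ))) := by
  haveI := nonempty_isReal (K := K)
  set d : ℕ := finrank ℚ K with hd
  have hd0 : 0 < d := finrank_pos
  have hd1 : 1 ≤ d := hd0
  have hdR : (0 : ℝ) < d := by exact_mod_cast hd0
  obtain ⟨c₁', hc₁', hmin⟩ := exists_ne_zero_mem_ideal_forall_lt K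
  set c₁ : ℝ := max c₁' 1 with hc₁def
  have hc₁1 : 1 ≤ c₁ := le_max_right _ _
  have hc₁0 : 0 < c₁ := by linarith
  obtain ⟨C_b, hCb⟩ :=
    Literature.Algebra.EuclideanLattices.abs_card_inter_coordBox_sub_le (realLatticeBasis K)
  set V : ℝ := volume.real (ZSpan.fundamentalDomain (realLatticeBasis K)) with hVdef
  have hV0 : 0 < V := Literature.Algebra.EuclideanLattices.measureReal_fundamentalDomain_pos _ _
  have hcardR : Fintype.card {w : InfinitePlace K // w.IsReal} = d := by
    rw [hd, IsTotallyReal.finrank]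
  set D : ℝ := √|((discr K : ℤ) : ℝ)| with hDdef
  set C_A : ℝ := c₁ ^ d * |C_b| * c₁ ^ ((d - 1) * (d - 1)) with hCA
  -- Step A: uniform bound with main term `∏(hi - lo)/(N𝔮 · V)`
  have hunif : ∀ (𝔮 : (Ideal (𝓞 K))⁰) (N : ℝ), 1 ≤ N →
      ∀ (lo hi : {w : InfinitePlace K // w.IsReal} → ℝ), (∀ w, lo w ≤ hi w) →
        (∀ w, hi w - lo w ≤ N) → ∀ α₀ : 𝓞 K,
      |(Nat.card {α : 𝓞 K // α ∈ cbox K lo hi ∧ α - α₀ ∈ (𝔮 : Ideal (𝓞 K))} : ℝ) -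
          (∏ w, (hi w - lo w)) / (Ideal.absNorm (𝔮 : Ideal (𝓞 K)) * V)| ≤
        C_A * (1 + (N ^ d / Ideal.absNorm (𝔮 : Ideal (𝓞 K))) ^ (1 - 1 / (d : ℝ))) := by
    intro 𝔮 N hN lo hi hlohi hside α₀
    have hN0 : 0 < N := by linarith
    set n : ℝ := (Ideal.absNorm (𝔮 : Ideal (𝓞 K)) : ℝ) with hn
    have hn1 : 1 ≤ n := by
      rw [hn]; exact_mod_cast Nat.one_le_iff_ne_zero.2 (Ideal.absNorm_ne_zero_of_nonZeroDivisors 𝔮)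
    have hn0 : 0 < n := by linarith
    obtain ⟨x₁, hx₁, hx₁0, hlt'⟩ := hmin 𝔮
    set C₀ : ℝ := c₁ * n ^ (1 / (d : ℝ)) with hC₀
    have hlt : ∀ w : InfinitePlace K, w (x₁ : K) < C₀ := fun w =>
      (hlt' w).trans_le (by rw [hC₀]; gcongr; exact le_max_left _ _)
    have hper := abs_card_cbox_coset_sub_le_of_short K hCb hx₁0 hx₁ hlt hN0 hlohi hside α₀
    have hA0 : 0 < |(Algebra.norm ℚ (x₁ : K) : ℝ)| := by
      rw [← absNorm_span_singleton_real]
      exact_mod_cast Nat.pos_of_ne_zero (by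
        rw [Ne, Ideal.absNorm_eq_zero_iff, Ideal.span_singleton_eq_bot]; exact hx₁0)
    have hcoef : ((Ideal.absNorm (Ideal.span ({x₁} : Set (𝓞 K))) : ℝ) / n) /
        (|(Algebra.norm ℚ (x₁ : K) : ℝ)| * V) * ∏ w, (hi w - lo w) =
          (∏ w, (hi w - lo w)) / (n * V) := by
      rw [absNorm_span_singleton_real]
      field_simp
    rw [hcoef] at hper
    refine hper.trans ?_
    have hrpow_d : (n ^ (1 / (d : ℝ))) ^ d = n := by
      rw [one_div, Real.rpow_inv_natCast_pow hn0.le hd0.ne']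
    have hindex : (Ideal.absNorm (Ideal.span ({x₁} : Set (𝓞 K))) : ℝ) / n ≤ c₁ ^ d := by
      rw [absNorm_span_singleton_real, div_le_iff₀ hn0, ← prod_isReal_apply_eq_abs_norm]
      calc ∏ w : {w : InfinitePlace K // w.IsReal}, w.1 (x₁ : K)
          ≤ ∏ _w : {w : InfinitePlace K // w.IsReal}, C₀ :=
            Finset.prod_le_prod (fun w _ => apply_nonneg _ _) fun w _ => (hlt w.1).le
        _ = C₀ ^ d := by rw [Finset.prod_const, Finset.card_univ, hcardR]
        _ = c₁ ^ d * n := by rw [hC₀, mul_pow, hrpow_d]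
    set u : ℝ := N ^ d / n with hu
    have hu0 : 0 ≤ u := by positivity
    set v : ℝ := u ^ (1 / (d : ℝ)) with hv
    have hv0 : 0 ≤ v := by positivity
    have hvpow : v ^ (d - 1) = u ^ (1 - 1 / (d : ℝ)) := by
      rw [hv, ← Real.rpow_natCast, ← Real.rpow_mul hu0, Nat.cast_sub hd1, Nat.cast_one,
        one_div_mul_eq_div, sub_div, div_self hdR.ne']
    have hside_eq : N * C₀ ^ (d - 1) / n = c₁ ^ (d - 1) * v := by
      have h1 : C₀ ^ (d - 1) = c₁ ^ (d - 1) * n ^ ((d - 1 : ℕ) * (1 / (d : ℝ))) := by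
        rw [hC₀, mul_pow, ← Real.rpow_natCast (n ^ (1 / (d : ℝ))), ← Real.rpow_mul hn0.le,
          mul_comm (1 / (d : ℝ))]
      have h2 : v = N / n ^ (1 / (d : ℝ)) := by
        rw [hv, hu, Real.div_rpow (by positivity) hn0.le, ← Real.rpow_natCast N,
          ← Real.rpow_mul hN0.le, mul_one_div_cancel hdR.ne', Real.rpow_one]
      rw [h1, h2, Nat.cast_sub hd1, Nat.cast_one, sub_mul, one_mul, mul_one_div_cancel hdR.ne',
        Real.rpow_sub hn0, Real.rpow_one]
      field_simp
    have hL : max 1 (N * C₀ ^ (d - 1) / n) ≤ c₁ ^ (d - 1) * max 1 v := by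
      rw [hside_eq]
      have hc : 1 ≤ c₁ ^ (d - 1) := one_le_pow₀ hc₁1
      refine max_le ?_ ?_
      · calc (1 : ℝ) = 1 * 1 := (mul_one _).symm
          _ ≤ c₁ ^ (d - 1) * max 1 v := mul_le_mul hc (le_max_left _ _) zero_le_one (by positivity)
      · exact mul_le_mul_of_nonneg_left (le_max_right _ _) (by positivity)
    have hLpow : (max 1 (N * C₀ ^ (d - 1) / n)) ^ (d - 1) ≤
        c₁ ^ ((d - 1) * (d - 1)) * (1 + u ^ (1 - 1 / (d : ℝ))) := by
      calc (max 1 (N * C₀ ^ (d - 1) / n)) ^ (d - 1) ≤ (c₁ ^ (d - 1) * max 1 v) ^ (d - 1) :=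
            pow_le_pow_left₀ (by positivity) hL _
        _ = c₁ ^ ((d - 1) * (d - 1)) * (max 1 v) ^ (d - 1) := by rw [mul_pow, ← pow_mul]
        _ ≤ c₁ ^ ((d - 1) * (d - 1)) * (1 + v ^ (d - 1)) := by
            refine mul_le_mul_of_nonneg_left ?_ (by positivity)
            rcases le_total v 1 with h | h
            · rw [max_eq_left h, one_pow]; linarith [pow_nonneg hv0 (d - 1)]
            · rw [max_eq_right h]; linarith
        _ = c₁ ^ ((d - 1) * (d - 1)) * (1 + u ^ (1 - 1 / (d : ℝ))) := by rw [hvpow]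
    have hCb' : C_b ≤ |C_b| := le_abs_self _
    calc (Ideal.absNorm (Ideal.span ({x₁} : Set (𝓞 K))) : ℝ) / n * C_b *
          (max 1 (N * C₀ ^ (d - 1) / n)) ^ (d - 1)
        ≤ c₁ ^ d * |C_b| * (c₁ ^ ((d - 1) * (d - 1)) * (1 + u ^ (1 - 1 / (d : ℝ)))) := by
          have h1 : (Ideal.absNorm (Ideal.span ({x₁} : Set (𝓞 K))) : ℝ) / n * C_b ≤
              (Ideal.absNorm (Ideal.span ({x₁} : Set (𝓞 K))) : ℝ) / n * |C_b| :=
            mul_le_mul_of_nonneg_left hCb' (by positivity)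
          have h2 : (Ideal.absNorm (Ideal.span ({x₁} : Set (𝓞 K))) : ℝ) / n * |C_b| ≤
              c₁ ^ d * |C_b| := mul_le_mul_of_nonneg_right hindex (abs_nonneg _)
          calc _ ≤ (Ideal.absNorm (Ideal.span ({x₁} : Set (𝓞 K))) : ℝ) / n * |C_b| *
                (max 1 (N * C₀ ^ (d - 1) / n)) ^ (d - 1) :=
                mul_le_mul_of_nonneg_right h1 (by positivity)
            _ ≤ c₁ ^ d * |C_b| * (max 1 (N * C₀ ^ (d - 1) / n)) ^ (d - 1) :=
                mul_le_mul_of_nonneg_right h2 (by positivity)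
            _ ≤ c₁ ^ d * |C_b| * (c₁ ^ ((d - 1) * (d - 1)) * (1 + u ^ (1 - 1 / (d : ℝ)))) :=
                mul_le_mul_of_nonneg_left hLpow (by positivity)
      _ = C_A * (1 + u ^ (1 - 1 / (d : ℝ))) := by rw [hCA]; ring
  -- Step B: `V = √|D_K|`, by comparison with the cube count `abs_card_box₀_sub_le`
  obtain ⟨C', hC'⟩ := abs_card_box₀_sub_le (K := K)
  have hD0 : 0 < D :=
    Real.sqrt_pos.2 (abs_pos.2 (Int.cast_ne_zero.2 (discr_ne_zero K)))
  have hVD : V⁻¹ = (D)⁻¹ := by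
    refine eq_of_forall_abs_sub_le_div (C := 2 * C_A + C') fun N hN => ?_
    have hN0 : 0 < N := by linarith
    have h1 := hunif 1 N hN (fun _ => 0) (fun _ => N) (fun _ => hN0.le) (fun _ => by simp) 0
    have h2 := hC' N hN
    have hcard : Nat.card {α : 𝓞 K // α ∈ cbox K (fun _ => 0) (fun _ => N) ∧
        α - 0 ∈ ((1 : (Ideal (𝓞 K))⁰) : Ideal (𝓞 K))} = Nat.card (box₀ K N) := by
      rw [box₀_eq_cbox]
      exact Nat.card_congr (Equiv.subtypeEquivRight fun α => by simp)
    rw [hcard] at h1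
    have hprodN : ∏ _w : {w : InfinitePlace K // w.IsReal}, (N - 0) = N ^ d := by
      rw [Finset.prod_const, Finset.card_univ, hcardR, sub_zero]
    simp only [OneMemClass.coe_one, Ideal.one_eq_top, Ideal.absNorm_top, Nat.cast_one, one_mul,
      div_one, hprodN] at h1
    have hpow : (N ^ d : ℝ) ^ (1 - 1 / (d : ℝ)) = N ^ (d - 1) := by
      rw [← Real.rpow_natCast N d, ← Real.rpow_mul hN0.le, ← Real.rpow_natCast N (d - 1),
        Nat.cast_sub hd1, Nat.cast_one, mul_sub, mul_one, mul_one_div_cancel hdR.ne']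
    rw [hpow] at h1
    have hNd1 : (1 : ℝ) ≤ N ^ (d - 1) := one_le_pow₀ hN
    have hCA0 : 0 ≤ C_A := by rw [hCA]; positivity
    have hdiff : |N ^ d / V - N ^ d / D| ≤ (2 * C_A + C') * N ^ (d - 1) := by
      calc |N ^ d / V - N ^ d / D|
          ≤ |(Nat.card (box₀ K N) : ℝ) - N ^ d / V| +
              |(Nat.card (box₀ K N) : ℝ) - N ^ d / D| := by
            rw [abs_sub_comm ((Nat.card (box₀ K N) : ℝ)) (N ^ d / V)]
            exact abs_sub_le _ _ _
        _ ≤ C_A * (1 + N ^ (d - 1)) + C' * N ^ (d - 1) := add_le_add h1 h2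
        _ ≤ C_A * (N ^ (d - 1) + N ^ (d - 1)) + C' * N ^ (d - 1) := by gcongr
        _ = (2 * C_A + C') * N ^ (d - 1) := by ring
    have hNd : (0 : ℝ) < N ^ d := by positivity
    have hkey : |V⁻¹ - (D)⁻¹| * N ^ d ≤ (2 * C_A + C') * N ^ (d - 1) := by
      have heq : N ^ d / V - N ^ d / D = (V⁻¹ - (D)⁻¹) * N ^ d := by ring
      rw [heq, abs_mul, abs_of_pos hNd] at hdiff
      exact hdiff
    rw [le_div_iff₀ hN0]
    have hNsplit : (N : ℝ) ^ d = N ^ (d - 1) * N := by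
      rw [← pow_succ, Nat.sub_add_cancel hd1]
    rw [hNsplit, ← mul_assoc] at hkey
    have hNd1pos : (0 : ℝ) < N ^ (d - 1) := by positivity
    nlinarith [hkey, abs_nonneg (V⁻¹ - (D)⁻¹)]
  have hV : V = D := inv_injective hVD
  refine ⟨C_A, fun 𝔮 N hN lo hi hlohi hside α₀ => ?_⟩
  have h := hunif 𝔮 N hN lo hi hlohi hside α₀
  rwa [hV] at h

/-! ### The shift estimate of Lemma 2.3: `A(N)` versus `A(N) + h` -/

omit [IsTotallyReal K] in
/-- The slab constant `c(h) = 1 + ∑_w |σ_w(h)|` (`> |σ_w(h)|` for every `w`, and `≥ 1`). [folklore] -/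
def shiftConst (h : 𝓞 K) : ℝ := 1 + ∑ w, |realEmb K h w|

omit [IsTotallyReal K] in
/-- `c(h) ≥ 1`. [folklore] -/
theorem one_le_shiftConst (h : 𝓞 K) : 1 ≤ shiftConst K h := by
  have : 0 ≤ ∑ w, |realEmb K h w| := Finset.sum_nonneg fun w _ => abs_nonneg _
  unfold shiftConst
  linarith

omit [IsTotallyReal K] in
/-- `|σ_w(h)| < c(h)`. [folklore] -/
theorem abs_realEmb_lt_shiftConst (h : 𝓞 K) (w : {w : InfinitePlace K // w.IsReal}) :
    |realEmb K h w| < shiftConst K h := by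
  have : |realEmb K h w| ≤ ∑ w', |realEmb K h w'| :=
    Finset.single_le_sum (f := fun w' => |realEmb K h w'|) (fun _ _ => abs_nonneg _)
      (Finset.mem_univ w)
  unfold shiftConst
  linarith

/-- Lower corner of the slab `S(w₀, jN)`: thickness `2c` in the direction `w₀` around `jN`,
`(−c, 2N + c]` in the other directions. [cite: CastilloEtAl2015, proof of Lemma 2.3 (first O-term)] -/
def slabLo (c N : ℝ) (w₀ : {w : InfinitePlace K // w.IsReal}) (j : Fin 3)
    (w : {w : InfinitePlace K // w.IsReal}) : ℝ :=
  if w = w₀ then ((j : ℕ) : ℝ) * N - c else -c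

/-- Upper corner of the slab `S(w₀, jN)`. [cite: CastilloEtAl2015, proof of Lemma 2.3 (first O-term)] -/
def slabHi (c N : ℝ) (w₀ : {w : InfinitePlace K // w.IsReal}) (j : Fin 3)
    (w : {w : InfinitePlace K // w.IsReal}) : ℝ :=
  if w = w₀ then ((j : ℕ) : ℝ) * N + c else 2 * N + c

/-- **The symmetric difference of `A(N)` and `A(N) + h` lies in `3d` slabs**: if exactly one of
`β`, `β − h` lies in `A(N)`, then for some real place `w₀` and some `j ∈ {0, 1, 2}`,
`jN − c < σ_{w₀}(β) ≤ jN + c` and `−c < σ_w(β) ≤ 2N + c` for all `w`, where `c = c(h)`.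
(Otherwise every `σ_w(β)` lies in `(c, N − c] ∪ (N + c, 2N − c]`, and since
`|σ_w(β) − σ_w(β − h)| < c` the box conditions for `β` and `β − h` agree coordinatewise.)
[cite: CastilloEtAl2015, proof of Lemma 2.3 ("it is α that is restricted to A(N) instead of α + h_m")] -/
theorem mem_slab_of_xor_mem_box {h β : 𝓞 K} {N : ℝ}
    (hx : Xor (β ∈ box K N) (β - h ∈ box K N)) :
    ∃ (w₀ : {w : InfinitePlace K // w.IsReal}) (j : Fin 3),
      β ∈ cbox K (slabLo K (shiftConst K h) N w₀ j) (slabHi K (shiftConst K h) N w₀ j) := by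
  set c := shiftConst K h with hc
  set x := realEmb K β with hxdef
  set y := realEmb K (β - h) with hydef
  have hxy : ∀ w, |x w - y w| < c := fun w => by
    have h1 : x w - y w = realEmb K h w := by
      have h2 : realEmb K β = realEmb K (β - h) + realEmb K h := by
        rw [← realEmb_add, sub_add_cancel]
      rw [hxdef, hydef, h2, Pi.add_apply]
      ring
    rw [h1]
    exact abs_realEmb_lt_shiftConst K h w
  have hc1 : 1 ≤ c := one_le_shiftConst K h
  have hmem : ∀ (γ : 𝓞 K) (M : ℝ), γ ∈ box₀ K M ↔ ∀ w, realEmb K γ w ∈ Ioc 0 M := fun γ M => by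
    rw [box₀_eq_cbox]
    rfl
  have hboxβ : β ∈ box K N ↔ (∀ w, x w ∈ Ioc 0 (2 * N)) ∧ ¬ ∀ w, x w ∈ Ioc 0 N := by
    rw [box, Set.mem_sdiff, hmem, hmem]
  have hboxβh : β - h ∈ box K N ↔ (∀ w, y w ∈ Ioc 0 (2 * N)) ∧ ¬ ∀ w, y w ∈ Ioc 0 N := by
    rw [box, Set.mem_sdiff, hmem, hmem]
  -- all coordinates of `β` lie in `(-c, 2N + c]`
  have hA : ∀ w, x w ∈ Ioc (-c) (2 * N + c) := by
    intro w
    rcases hx.or with hb | hb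
    · have h1 := (hboxβ.1 hb).1 w
      rw [Set.mem_Ioc] at h1 ⊢
      constructor <;> linarith [h1.1, h1.2]
    · have h1 := (hboxβh.1 hb).1 w
      have h2 := hxy w
      rw [abs_lt] at h2
      rw [Set.mem_Ioc] at h1 ⊢
      constructor <;> linarith [h1.1, h1.2, h2.1, h2.2]
  by_contra hcon
  push Not at hcon
  have hnot : ∀ (w : {w : InfinitePlace K // w.IsReal}) (j : Fin 3),
      ¬ (x w ∈ Ioc (((j : ℕ) : ℝ) * N - c) (((j : ℕ) : ℝ) * N + c)) := by
    intro w j hwj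
    refine hcon w j (fun w' => ?_)
    change x w' ∈ Ioc (slabLo K c N w j w') (slabHi K c N w j w')
    by_cases hw' : w' = w
    · subst hw'
      simp only [slabLo, slabHi, if_true]
      exact hwj
    · simp only [slabLo, slabHi, if_neg hw']
      exact hA w'
  have hagree : ∀ w, (x w ∈ Ioc 0 N ↔ y w ∈ Ioc 0 N) ∧ x w ∈ Ioc 0 (2 * N) ∧ y w ∈ Ioc 0 (2 * N) := by
    intro w
    have h0 := hnot w 0
    have h1 := hnot w 1
    have h2 := hnot w 2
    simp only [Fin.val_zero, Fin.val_one, Fin.val_two, Nat.cast_zero, Nat.cast_one, Nat.cast_ofNat,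
      zero_mul, one_mul, zero_sub, zero_add, Set.mem_Ioc, not_and, not_le] at h0 h1 h2
    have hAw := hA w
    rw [Set.mem_Ioc] at hAw
    have hxyw := hxy w
    rw [abs_lt] at hxyw
    have hxc : c < x w := by
      by_contra h'
      exact absurd (h0 hAw.1) (not_lt.2 (not_lt.1 h'))
    have hx2 : x w ≤ 2 * N - c := by
      by_contra h'
      exact absurd (h2 (not_le.1 h')) (not_lt.2 hAw.2)
    have hx1 : x w ≤ N - c ∨ N + c < x w := by
      by_contra h'
      push Not at h'
      exact absurd (h1 h'.1) (not_lt.2 h'.2)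
    simp only [Set.mem_Ioc]
    refine ⟨⟨fun hxN => ⟨by linarith, ?_⟩, fun hyN => ⟨by linarith, ?_⟩⟩, ⟨by linarith, by linarith⟩,
      ⟨by linarith, by linarith⟩⟩
    · rcases hx1 with h' | h'
      · linarith
      · linarith [hxN.2]
    · rcases hx1 with h' | h'
      · linarith
      · linarith [hyN.2]
  have hiff : β ∈ box K N ↔ β - h ∈ box K N := by
    rw [hboxβ, hboxβh]
    constructor
    · rintro ⟨-, hn⟩
      exact ⟨fun w => (hagree w).2.2, fun hall => hn fun w => (hagree w).1.2 (hall w)⟩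
    · rintro ⟨-, hn⟩
      exact ⟨fun w => (hagree w).2.1, fun hall => hn fun w => (hagree w).1.1 (hall w)⟩
  rcases hx with ⟨h1, h2⟩ | ⟨h1, h2⟩
  · exact h2 (hiff.1 h1)
  · exact h2 (hiff.2 h1)

/-- **One slab** of the shift estimate: for `c = c(h)`, every nonzero `𝔮`, `N ≥ 1`, class `a`,
direction `w₀` and `j ∈ {0,1,2}`, the slab `S(w₀, jN)` (volume `2c(2N + 2c)^{d−1} ≤ 2c(4cN)^{d−1}`,
sides `≤ 2N + 2c ≤ 4cN`) contains
`≤ C₁ (N^{d−1}/N𝔮 + 1 + (N^d/N𝔮)^{1−1/d})` elements of `a + 𝔮`, by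
`abs_card_cbox_coset_sub_le_uniform`. [cite: CastilloEtAl2015, proof of Lemma 2.3 (first O-term)] -/
theorem card_slab_coset_le (h : 𝓞 K) :
    ∃ C₁ : ℝ, 0 ≤ C₁ ∧ ∀ (𝔮 : (Ideal (𝓞 K))⁰) (N : ℝ), 1 ≤ N → ∀ (a : 𝓞 K)
      (w₀ : {w : InfinitePlace K // w.IsReal}) (j : Fin 3),
      (Nat.card {α : 𝓞 K // α ∈ cbox K (slabLo K (shiftConst K h) N w₀ j)
          (slabHi K (shiftConst K h) N w₀ j) ∧ α - a ∈ (𝔮 : Ideal (𝓞 K))} : ℝ) ≤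
        C₁ * (N ^ (finrank ℚ K - 1) / Ideal.absNorm (𝔮 : Ideal (𝓞 K)) +
          (1 + (N ^ finrank ℚ K / Ideal.absNorm (𝔮 : Ideal (𝓞 K))) ^
            (1 - 1 / (finrank ℚ K : ℝ)))) := by
  haveI := nonempty_isReal (K := K)
  have hd0 : 0 < finrank ℚ K := finrank_pos
  have hd1 : 1 ≤ finrank ℚ K := hd0
  have hdR : (0 : ℝ) < finrank ℚ K := by exact_mod_cast hd0
  have hcardR : Fintype.card {w : InfinitePlace K // w.IsReal} = finrank ℚ K := by
    rw [IsTotallyReal.finrank]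
  have hc1 : 1 ≤ shiftConst K h := one_le_shiftConst K h
  have hc0 : 0 < shiftConst K h := by linarith
  have hD0 : 0 < √|((discr K : ℤ) : ℝ)| :=
    Real.sqrt_pos.2 (abs_pos.2 (Int.cast_ne_zero.2 (discr_ne_zero K)))
  have he0 : 0 ≤ 1 - 1 / (finrank ℚ K : ℝ) := by
    rw [sub_nonneg, div_le_one hdR]
    exact_mod_cast hd1
  have he1 : 1 - 1 / (finrank ℚ K : ℝ) ≤ 1 := by linarith [one_div_pos.2 hdR]
  obtain ⟨C₀, hC₀⟩ := abs_card_cbox_coset_sub_le_uniform K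
  -- abbreviations (plain variables, fixed by equations)
  obtain ⟨d, hd⟩ : ∃ d : ℕ, d = finrank ℚ K := ⟨_, rfl⟩
  obtain ⟨c, hc⟩ : ∃ c : ℝ, c = shiftConst K h := ⟨_, rfl⟩
  obtain ⟨D, hD⟩ : ∃ D : ℝ, D = √|((discr K : ℤ) : ℝ)| := ⟨_, rfl⟩
  obtain ⟨e, he⟩ : ∃ e : ℝ, e = 1 - 1 / (finrank ℚ K : ℝ) := ⟨_, rfl⟩
  rw [← he] at he0 he1 hC₀ ⊢
  rw [← hd] at hcardR hC₀ hd1 ⊢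
  rw [← hc] at hc1 hc0
  rw [← hD] at hD0 hC₀
  refine ⟨2 * c * (4 * c) ^ (d - 1) / D + |C₀| * (4 * c) ^ d, by positivity,
    fun 𝔮 N hN a w₀ j => ?_⟩
  rw [← hc]
  have hN0 : 0 < N := by linarith
  obtain ⟨n, hn⟩ : ∃ n : ℝ, n = (Ideal.absNorm (𝔮 : Ideal (𝓞 K)) : ℝ) := ⟨_, rfl⟩
  have hn1 : 1 ≤ n := by
    rw [hn]; exact_mod_cast Nat.one_le_iff_ne_zero.2 (Ideal.absNorm_ne_zero_of_nonZeroDivisors 𝔮)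
  have hn0 : 0 < n := by linarith
  rw [← hn]
  obtain ⟨u, hu⟩ : ∃ u : ℝ, u = N ^ d / n := ⟨_, rfl⟩
  have hu0 : 0 ≤ u := by rw [hu]; positivity
  rw [← hu]
  -- the slab
  obtain ⟨lo, hlo⟩ : ∃ lo : {w : InfinitePlace K // w.IsReal} → ℝ, lo = slabLo K c N w₀ j := ⟨_, rfl⟩
  obtain ⟨hi, hhi⟩ : ∃ hi : {w : InfinitePlace K // w.IsReal} → ℝ, hi = slabHi K c N w₀ j := ⟨_, rfl⟩
  rw [← hlo, ← hhi]
  have hdiffw : ∀ w, hi w - lo w = if w = w₀ then 2 * c else 2 * N + 2 * c := fun w => by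
    simp only [hhi, hlo, slabHi, slabLo]
    split_ifs <;> ring
  have hlohi : ∀ w, lo w ≤ hi w := fun w => by
    have := hdiffw w
    split_ifs at this <;> linarith
  have hside : ∀ w, hi w - lo w ≤ 2 * N + 2 * c := fun w => by
    rw [hdiffw w]
    split_ifs <;> linarith
  have h := hC₀ 𝔮 (2 * N + 2 * c) (by linarith) lo hi hlohi hside a
  clear hC₀
  rw [← hn] at h
  -- the volume of the slab
  have hprod : ∏ w, (hi w - lo w) = 2 * c * (2 * N + 2 * c) ^ (d - 1) := by
    simp_rw [hdiffw]
    rw [← Finset.mul_prod_erase Finset.univ _ (Finset.mem_univ w₀), if_pos rfl]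
    congr 1
    rw [Finset.prod_congr rfl fun w hw => if_neg (Finset.ne_of_mem_erase hw), Finset.prod_const,
      Finset.card_erase_of_mem (Finset.mem_univ _), Finset.card_univ, hcardR]
  have h2N : 2 * N + 2 * c ≤ 4 * c * N := by nlinarith
  have hprod_le : ∏ w, (hi w - lo w) ≤ 2 * c * (4 * c) ^ (d - 1) * N ^ (d - 1) := by
    rw [hprod, mul_assoc (2 * c) ((4 * c) ^ (d - 1)), ← mul_pow]
    exact mul_le_mul_of_nonneg_left (pow_le_pow_left₀ (by positivity) h2N _) (by positivity)
  -- the error of the slab: `(2N+2c)^d ≤ (4c)^d N^d`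
  have herr : ((2 * N + 2 * c) ^ d / n) ^ e ≤ (4 * c) ^ d * u ^ e := by
    have h1 : (2 * N + 2 * c) ^ d / n ≤ (4 * c) ^ d * u := by
      rw [hu, ← mul_div_assoc, ← mul_pow]
      exact div_le_div_of_nonneg_right (pow_le_pow_left₀ (by positivity) h2N _) hn0.le
    have h4c : (1 : ℝ) ≤ (4 * c) ^ d := one_le_pow₀ (by linarith)
    have h4c0 : (0 : ℝ) ≤ (4 * c) ^ d := by positivity
    calc ((2 * N + 2 * c) ^ d / n) ^ e ≤ ((4 * c) ^ d * u) ^ e :=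
          Real.rpow_le_rpow (by positivity) h1 he0
      _ = ((4 * c) ^ d) ^ e * u ^ e := Real.mul_rpow h4c0 hu0
      _ ≤ (4 * c) ^ d * u ^ e := by
          refine mul_le_mul_of_nonneg_right ?_ (Real.rpow_nonneg hu0 e)
          calc ((4 * c) ^ d) ^ e ≤ ((4 * c) ^ d) ^ (1 : ℝ) :=
                Real.rpow_le_rpow_of_exponent_le h4c he1
            _ = (4 * c) ^ d := Real.rpow_one _
  have hue0 : 0 ≤ u ^ e := Real.rpow_nonneg hu0 e
  have hcount : (Nat.card {α : 𝓞 K // α ∈ cbox K lo hi ∧ α - a ∈ (𝔮 : Ideal (𝓞 K))} : ℝ) ≤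
      (∏ w, (hi w - lo w)) / (n * D) + |C₀| * (1 + ((2 * N + 2 * c) ^ d / n) ^ e) := by
    have h1 := (abs_le.1 h).2
    have h2 : C₀ * (1 + ((2 * N + 2 * c) ^ d / n) ^ e) ≤ |C₀| * (1 + ((2 * N + 2 * c) ^ d / n) ^ e) :=
      mul_le_mul_of_nonneg_right (le_abs_self _)
        (add_nonneg zero_le_one (Real.rpow_nonneg (by positivity) e))
    linarith
  have hstep1 : (∏ w, (hi w - lo w)) / (n * D) ≤ (2 * c * (4 * c) ^ (d - 1) / D) * (N ^ (d - 1) / n) := by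
    have heq : (2 * c * (4 * c) ^ (d - 1) / D) * (N ^ (d - 1) / n) =
        (2 * c * (4 * c) ^ (d - 1) * N ^ (d - 1)) / (n * D) := by
      field_simp
    rw [heq]
    exact div_le_div_of_nonneg_right hprod_le (by positivity)
  have hstep2 : |C₀| * (1 + ((2 * N + 2 * c) ^ d / n) ^ e) ≤ (|C₀| * (4 * c) ^ d) * (1 + u ^ e) := by
    have h4c : (1 : ℝ) ≤ (4 * c) ^ d := one_le_pow₀ (by linarith)
    calc |C₀| * (1 + ((2 * N + 2 * c) ^ d / n) ^ e) ≤ |C₀| * (1 + (4 * c) ^ d * u ^ e) :=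
          mul_le_mul_of_nonneg_left (by linarith) (abs_nonneg _)
      _ ≤ |C₀| * ((4 * c) ^ d * (1 + u ^ e)) := by
          refine mul_le_mul_of_nonneg_left ?_ (abs_nonneg _)
          nlinarith
      _ = (|C₀| * (4 * c) ^ d) * (1 + u ^ e) := by ring
  have hA0 : 0 ≤ 2 * c * (4 * c) ^ (d - 1) / D := by positivity
  have hB0 : 0 ≤ |C₀| * (4 * c) ^ d := by positivity
  have hx0 : 0 ≤ N ^ (d - 1) / n := by positivity
  calc (Nat.card {α : 𝓞 K // α ∈ cbox K lo hi ∧ α - a ∈ (𝔮 : Ideal (𝓞 K))} : ℝ)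
      ≤ (2 * c * (4 * c) ^ (d - 1) / D) * (N ^ (d - 1) / n) + (|C₀| * (4 * c) ^ d) * (1 + u ^ e) := by
        linarith
    _ ≤ (2 * c * (4 * c) ^ (d - 1) / D + |C₀| * (4 * c) ^ d) * (N ^ (d - 1) / n) +
          (2 * c * (4 * c) ^ (d - 1) / D + |C₀| * (4 * c) ^ d) * (1 + u ^ e) := by
        nlinarith
    _ = (2 * c * (4 * c) ^ (d - 1) / D + |C₀| * (4 * c) ^ d) * (N ^ (d - 1) / n + (1 + u ^ e)) := by
        ring

/-- **The shift estimate** (the "first `O`-term" of the proof of Lemma 2.3, for totally real `K`):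
for every `h ∈ 𝓞_K` there is `C = C(K, h)` such that for every nonzero ideal `𝔮`, every `N ≥ 1`
and every class `a`, the number of `β ≡ a (mod 𝔮)` lying in exactly one of `A(N)`, `A(N) + h` is
`≤ C (N^{d−1}/N𝔮 + 1 + (N^d/N𝔮)^{1−1/d})` — the `3d` slabs of `mem_slab_of_xor_mem_box`, each
counted by `card_slab_coset_le`.
[cite: CastilloEtAl2015, proof of Lemma 2.3 (first O-term, (|A(N)|/|𝔴∏[𝔡ᵢ,𝔢ᵢ]|)^{1−ν})] -/
theorem card_xor_box_shift_coset_le (h : 𝓞 K) :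
    ∃ C : ℝ, ∀ (𝔮 : (Ideal (𝓞 K))⁰) (N : ℝ), 1 ≤ N → ∀ a : 𝓞 K,
      (Nat.card {β : 𝓞 K // Xor (β ∈ box K N) (β - h ∈ box K N) ∧
          β - a ∈ (𝔮 : Ideal (𝓞 K))} : ℝ) ≤
        C * (N ^ (finrank ℚ K - 1) / Ideal.absNorm (𝔮 : Ideal (𝓞 K)) +
          (1 + (N ^ finrank ℚ K / Ideal.absNorm (𝔮 : Ideal (𝓞 K))) ^
            (1 - 1 / (finrank ℚ K : ℝ)))) := by
  obtain ⟨C₁, hC₁0, hC₁⟩ := card_slab_coset_le K h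
  have hcardR : Fintype.card {w : InfinitePlace K // w.IsReal} = finrank ℚ K := by
    rw [IsTotallyReal.finrank]
  refine ⟨3 * finrank ℚ K * C₁, fun 𝔮 N hN a => ?_⟩
  set bound : ℝ := C₁ * (N ^ (finrank ℚ K - 1) / Ideal.absNorm (𝔮 : Ideal (𝓞 K)) +
    (1 + (N ^ finrank ℚ K / Ideal.absNorm (𝔮 : Ideal (𝓞 K))) ^ (1 - 1 / (finrank ℚ K : ℝ))))
    with hbound
  have hslab := hC₁ 𝔮 N hN a
  -- the union bound over the `3d` slabs
  have hfinp : ∀ p : {w : InfinitePlace K // w.IsReal} × Fin 3,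
      {α : 𝓞 K | α ∈ cbox K (slabLo K (shiftConst K h) N p.1 p.2)
        (slabHi K (shiftConst K h) N p.1 p.2) ∧ α - a ∈ (𝔮 : Ideal (𝓞 K))}.Finite := fun p =>
    (finite_cbox _ _).subset fun α hα => hα.1
  set T : {w : InfinitePlace K // w.IsReal} × Fin 3 → Finset (𝓞 K) := fun p => (hfinp p).toFinset
    with hT
  have hTcard : ∀ p, ((T p).card : ℝ) =
      Nat.card {α : 𝓞 K // α ∈ cbox K (slabLo K (shiftConst K h) N p.1 p.2)
        (slabHi K (shiftConst K h) N p.1 p.2) ∧ α - a ∈ (𝔮 : Ideal (𝓞 K))} := fun p => by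
    rw [hT, ← Set.ncard_eq_toFinset_card _ (hfinp p), ← Nat.card_coe_set_eq]
    rfl
  set S : Set (𝓞 K) := {β | Xor (β ∈ box K N) (β - h ∈ box K N) ∧ β - a ∈ (𝔮 : Ideal (𝓞 K))}
    with hS
  have hSsub : S ⊆ ⋃ p, (T p : Set (𝓞 K)) := by
    intro β hβ
    obtain ⟨w₀, j, hmem⟩ := mem_slab_of_xor_mem_box K hβ.1
    refine Set.mem_iUnion.2 ⟨(w₀, j), ?_⟩
    rw [hT, Set.Finite.coe_toFinset]
    exact ⟨hmem, hβ.2⟩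
  have hSfin : S.Finite := (Set.finite_iUnion fun p => (T p).finite_toSet).subset hSsub
  have hScard : (Nat.card {β : 𝓞 K // Xor (β ∈ box K N) (β - h ∈ box K N) ∧
      β - a ∈ (𝔮 : Ideal (𝓞 K))} : ℝ) = hSfin.toFinset.card := by
    rw [← Set.ncard_eq_toFinset_card _ hSfin, ← Nat.card_coe_set_eq]
    rfl
  rw [hScard]
  have hsub : hSfin.toFinset ⊆ Finset.univ.biUnion T := by
    intro β hβ
    rw [Set.Finite.mem_toFinset] at hβ
    obtain ⟨p, hp⟩ := Set.mem_iUnion.1 (hSsub hβ)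
    exact Finset.mem_biUnion.2 ⟨p, Finset.mem_univ _, hp⟩
  calc (hSfin.toFinset.card : ℝ) ≤ ((Finset.univ.biUnion T).card : ℝ) := by
        exact_mod_cast Finset.card_le_card hsub
    _ ≤ ∑ p, ((T p).card : ℝ) := by exact_mod_cast Finset.card_biUnion_le
    _ ≤ ∑ _p : {w : InfinitePlace K // w.IsReal} × Fin 3, bound :=
        Finset.sum_le_sum fun p _ => by rw [hTcard, hbound]; exact hslab p.1 p.2
    _ = 3 * finrank ℚ K * bound := by
        rw [Finset.sum_const, Finset.card_univ, Fintype.card_prod, Fintype.card_fin, hcardR,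
          nsmul_eq_mul]
        push_cast
        ring
    _ = _ := by rw [hbound]; ring

end TotallyReal

end Literature.NumberTheory.Sieve.CastilloEtAl2015
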